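import Literature.MathematicalPhysics.QuantumFieldTheory.Balaban1983to89.B9Eq3133H1kPiTwoBackgroundSupRowsTower
import Literature.MathematicalPhysics.QuantumFieldTheory.Balaban1983to89.B11Eq117ReadLettersBridge
import Literature.MathematicalPhysics.QuantumFieldTheory.Balaban1983to89.B11Eq117LetterDefects

/-!
# `Balaban1983to89.B11Eq117H1kPiLetterDefectAtFlatLatticeFree` — T. Bałaban, *Averaging operations for lattice gauge theories*, Commun. Math. Phys. **98** (1985) 17–51 [Balaban1985Variational]
# (117) p. 295 *«|δA| ≤ (1 + |B|)O(ε)»*, (115) p. 294, (103) p. 293, (45) p. 285; with [Balaban1985BackgroundPropagators] (3.122) p. 420, (3.126) p. 420, (3.131)–(3.133) p. 422, Thm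
# 3.4 p. 400, (3.3) p. 391: **THE `H₁`-LETTER DEFECT `δ̃_A` OF THE CHART ACTUALLY INSTANTIATED (print's minimizer `H̃_k = G̃_kQ_k†(Q_kG̃_kQ_k†)⁻¹`, operator (3.122)) AT THE FLAT
# POINT, IN THE (115)∕(117) NORMS, FREE OF THE LATTICE — `‖ι(H̃_k(U)B) − H_k(1)B‖_(115),∇_1 ≤ max(w̄₀, w̄₁)·M_φ·(j₀ + α)K·M_φ′·w̲_B⁻¹·‖B‖` (no `|η|⁻¹`, no bond count), with the
# jet identity `‖ι_{∇_U→∇_1}f‖ ≤ (1 + w̄₁·2α·w̲₀⁻¹)‖f‖`** — the π-twin of gen 101's `B11Eq117H1kLetterDefectAtFlatLatticeFree` (the chain's `H_k`), fed by the two lattice-free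
# sup rows of gen 101's `B9Eq3133H1kPiTwoBackgroundSupRowsTower` through the OWNER's socket `B11Eq117ReadLettersBridge.norm_H1CLM_le_of_global`; `H̃_k(1) = H_k(1)`
# (`B9Eq3119DeltaPiTowerFlat.H1LatticeK_laplaceAkPi_one`), so this IS the two-background defect of print's `H̃_k`-letter across the two norms

statement-level skeleton of published theorems with citation tags; proofs where landed; nothing here is a claim about the Yang–Mills mass gap

CITATION HEADER (lean-in-tree rule).  Audit cell `pub-balaban`, sub-cell `t4`, BINDER row NE9; filed by NE9 crux-team LEAF PROVER 01 (`b2b-balaban-t4-ne9-formalise-leaf-01`, gen 101;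
ROUTE (J′), π-side — the (117) face; bears_on: R4/N22).  Composition BY NAME: this lineage's gen-101 `B9Eq3133H1kPiTwoBackgroundSupRowsTower.exists_supRows_H1kPi_sub_flat`; the
OWNER's `B11Eq117ReadLettersBridge.norm_H1CLM_le_of_global`, `B11Eq103H1Complex.{H1LatticeCLM, H1CLM, blockCLM115_apply}`, `B11Eq117LetterDefects.{norm_jetId_le,
norm_nabla115_sub_flat_le, readFun_sub}`.  Source READ first-hand in the held text layers `paper:balaban1985-cmp98-averaging` p. 295 and `paper:balaban1985-cmp99-background-propagators`
(journal page = PDF page + 388) pp. 400, 420–422.  NOTHING of print's proofs is reproduced: [folklore] (the text of `B11Eq117H1kLetterDefectAtFlatLatticeFree` with the π letter).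

WHAT IS PROVED (sorry-free; proof lane — 0 `def`; [folklore]).
* **`exists_H1kPi_letterDefect_at_flat_latticeFree`** — `∃ α₁ j₁ > 0, K ≥ 0` BEFORE the binder block of `exists_supRows_H1kPi_sub_flat` (`[Fact (0 < η)]` added) `+ hQ1 + (lev₀ levB lev₁)`;
  conclusion: (K_ι) `‖ι_{∇_U→∇_1}f‖ ≤ (1 + w̄₁·(2α)·w̲₀⁻¹)·‖f‖` and (δ̃_A) `‖ι(H1LatticeCLM φ hposπ hQ lev₁ (∇_U) B) − H1LatticeCLM …(flat data)… φ hpos₁ hQ1 lev₁ (∇_1) B‖ ≤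
  max(w̄₀·(M_φ((j₀ + α)K)M_φ′), w̄₁·(M_φ((j₀ + α)K)M_φ′))·w̲_B⁻¹·‖B‖`.
HONEST SCOPE.  Composition BY NAME on the cell's MODEL rows (O-NE9-1, #5 UNRULED); constants crude (NOT print's `O(ε)` with its constant); `j₀` and `α` displayed separately (their relation
on print's class is lit-balaban's `B9Eq336CurrentBound`); first order at the flat point only (NOT two general backgrounds); the windows, `c₀ = η^d`, unitarity, the tower data, `hαL`, the
positivity and onto witnesses at `U` and at `1` stay HYPOTHESES; the `𝔊̃`-letter defect `δ̃_G` and the remaining (117) entries are NOT here; nothing of [B11] (117) or [B9] Thm 3.4 asserted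
as printed; «NE9 ⇐ the named binders»; NE9 NOT PRINTED ∕ NOT PROVED; spine PROVED 0∕9; rung (B)+1 on a finite T⁴ — NOT infinite volume, NOT mass gap, NOT BetaPertH, NOT Clay.  HONEST
DEPENDENCY: continuum YM on T⁴ ⇐ BetaPertH ∧ nine spine estimates (0/9 proved); BetaPertH ⇐ (D1) ∧ (D4) ∧ CAP+tail; G-an2-4 gates asym, D1 and NE2/3/4.  NEW file; nothing modified.
Net new unproved facts: 0.
-/

noncomputable section

open scoped InnerProductSpace ComplexConjugate BigOperators

namespace Literature.MathematicalPhysics.QuantumFieldTheory.Balaban1983to89.B11Eq117H1kPiLetterDefectAtFlatLatticeFree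

open B4Sect5Torus (TSite)
open B9SectCLatticeCarrier (Bond bpos shift unshift)
open B9Eq311L2Pairing (WL2)
open B7Prop1Explicit (U1 Wcx boxVec)
open B11Eq103H1Complex (SiteL2K BondL2K H1LatticeK H1LatticeCLM H1CLM blockCLM115_apply readFun)
open B11Eq115Space (NegSize Space115 levWeight NegSup JetSup)
open B11Eq111FrakG (nabla115 jetLinearEquiv)
open B9Eq33CovDerivVector (covGrad)
open B9Eq310DeltaPrime (plaqHolU)
open B9Eq310HessianOperator (adTransportW hessOp)
open B9Eq315QTorus (perCfg cornerSite)
open B9Eq315QTower (towerP UlevOf)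
open B9Eq315QTowerFlat (perCfg_UlevOf_one_mem_U1 norm_Wcx_UlevOf_one_sub_one_le)
open B9Eq326OperatorTower (laplaceAk H1k QkW RofUk)
open B9Eq324DeltaPrimeATower (laplacePrimeAk)
open B11Eq117LetterDefects (norm_jetId_le norm_nabla115_sub_flat_le readFun_sub)
open B11Eq117ReadLettersBridge (norm_H1CLM_le_of_global)
open B9Eq3119DeltaPiTower (laplaceAkPi)
open B9Eq3133H1kPiTwoBackgroundSupRowsTower (exists_supRows_H1kPi_sub_flat)

variable {d : ℕ} (hd : 1 ≤ d) (L : ℕ) [NeZero L] (hL : 1 ≤ L) (hL3 : 3 ≤ L)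
  {𝔸 : Type*} [NormedRing 𝔸] [NormedAlgebra ℂ 𝔸] [CompleteSpace 𝔸] [NormOneClass 𝔸] [StarRing 𝔸] [NormedStarGroup 𝔸] [StarModule ℂ 𝔸] [FiniteDimensional ℂ 𝔸]
  {W : Type*} [NormedAddCommGroup W] [InnerProductSpace ℂ W] [FiniteDimensional ℂ W] (φ : W ≃ₗ[ℂ] 𝔸)
  {Mφ Mφ' : ℝ} (hMφ : 0 ≤ Mφ) (hMφ' : 0 ≤ Mφ') (hφ : ∀ w, ‖φ w‖ ≤ Mφ * ‖w‖) (hφ' : ∀ X, ‖φ.symm X‖ ≤ Mφ' * ‖X‖) (hstar : ∀ X : 𝔸, ‖star X‖ ≤ ‖X‖)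
  {a : ℝ} (ha : 0 < a) {a' : ℝ} (ha' : 0 < a') {ϱ : ℝ} (hϱ0 : 0 ≤ ϱ) (hϱ1 : ϱ < 1)
  (τ : 𝔸 →ₗ[ℂ] ℂ) {Cτ : ℝ} (hτ : ∀ X, ‖τ X‖ ≤ Cτ * ‖X‖) (hCτ : 0 ≤ Cτ) {Mτ : ℝ} (hτm : ∀ X Y : 𝔸, ‖τ (X * Y)‖ ≤ Mτ * ‖X‖ * ‖Y‖) (hMτ : 0 ≤ Mτ)
  {ρw : ℝ} (hρw : 0 ≤ ρw)
  (hτ₁ : ∀ X : 𝔸, τ (star X) = conj (τ X)) (hτ₂ : ∀ X Y : 𝔸, τ (X * Y) = τ (Y * X)) (hφτ : ∀ X Y : 𝔸, ⟪φ.symm X, φ.symm Y⟫_ℂ = τ (star X * Y))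
  (AQ : ℝ)
  {ι : Type} [Fintype ι] [DecidableEq ι] (b : Module.Basis ι ℝ 𝔸) {M₂ : ℝ} (hM₂ : 0 ≤ M₂) (hrepr : ∀ (v : 𝔸) (i : ι), |b.repr v i| ≤ M₂ * ‖v‖)

/-! ## The `H̃`-letter defect and the jet identity at the flat point, lattice-free -/

include hd hL hL3 hMφ hMφ' hφ hφ' hstar ha ha' hϱ0 hϱ1 hτ hCτ hτm hMτ hρw hτ₁ hτ₂ hφτ hM₂ hrepr in
set_option maxHeartbeats 3200000 in
set_option maxRecDepth 8192 in
/-- **THE `H̃`-LETTER DEFECT `δ̃_A` AND THE JET IDENTITY `K_ι` OF THE CHART ACTUALLY INSTANTIATED, AT THE FLAT POINT, LATTICE-FREE** — see the module docstring. [folklore]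
[cite: Balaban1985Variational, (115) p.294, (117) p.295, (103) p.293, (45) p.285; Balaban1985BackgroundPropagators, (3.122) p.420, (3.126) p.420, (3.131)–(3.133) p.422, Thm 3.4 p.400, (3.3) p.391] -/
theorem exists_H1kPi_letterDefect_at_flat_latticeFree [Fact (0 < (L : ℝ))] :
    ∃ α₁ j₁ K : ℝ, 0 < α₁ ∧ 0 < j₁ ∧ 0 ≤ K ∧
      ∀ (n : ℕ) (η : ℝ) [Fact (0 < η)] (_hηL : η * (L : ℝ) ^ (n + 1) = 1) (c₀ c₁ : ℝ) [Fact (0 < c₀)] [Fact (0 < c₁)]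
        (_hw : c₀ * ((L : ℝ) ^ (n + 1)) ^ d = c₁) (_hρ : |η| ^ d / c₀ ≤ ρw) (m : Fin d → ℕ) [∀ i, NeZero (m i)] (_hm : ∀ i, 1 ≤ m i)
        (U : Bond d (towerP L m (n + 1)) → 𝔸ˣ) (αU : ℕ → ℝ) (_hα0 : ∀ j, 0 ≤ αU j) (hα1 : ∀ j, αU j ≤ 1 / 64)
        (hαL : ∀ j, 50 * (d + 1) * αU j * (L : ℝ) ^ d ≤ 1 / 2)
        (hU1 : ∀ (j : ℕ) (x : B7Prop1Explicit.Site d) (k : Fin d), perCfg (towerP L m (j + 1)) (UlevOf L m (n + 1) U j) x k ∈ U1 𝔸)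
        (hreg : ∀ (j : ℕ) (y : TSite d (towerP L m j)) (k : Fin d) (ρ' : Fin d → Fin L),
          ‖((Wcx L (perCfg (towerP L m (j + 1)) (UlevOf L m (n + 1) U j)) (cornerSite L y) k (boxVec L ρ') : 𝔸ˣ) : 𝔸) - 1‖ ≤ αU j)
        (εU : ℕ → ℝ) (_hεU : ∀ j, 0 ≤ εU j) (_hε1 : ∀ j, εU j ≤ 1) (_hUε : ∀ (j : ℕ) (b : Bond d (towerP L m (j + 1))), ‖(UlevOf L m (n + 1) U j b : 𝔸) - 1‖ ≤ εU j)
        (_hLb : ∀ (j : ℕ) (b : Bond d (towerP L m (j + 1))), UlevOf L m (n + 1) U j b ∈ U1 𝔸)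
        (α : ℝ) (_hα : 0 ≤ α) (_hαle : α ≤ α₁)
        (hUst : ∀ b, star (U b : 𝔸) = (((U b)⁻¹ : 𝔸ˣ) : 𝔸)) (_hUb : ∀ b, U b ∈ U1 𝔸) (_hUη : ∀ b, ‖(U b : 𝔸) - 1‖ ≤ α * η)
        (_hUw : ∀ (x : TSite d (towerP L m (n + 1))) (μ ν : Fin d), ‖(U (shift ν x, μ) : 𝔸) - (U (x, μ) : 𝔸)‖ ≤ α * η ^ 2)
        (_hpl : ∀ p : B9SectCLatticeCarrier.Plaq d (towerP L m (n + 1)), ‖(plaqHolU U p : 𝔸) - 1‖ ≤ α * η ^ 2)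
        (_hUgrad : ∀ (x : TSite d (towerP L m (n + 1))) (μ : Fin d), ‖(U (x, μ) : 𝔸) - U (unshift μ x, μ)‖ ≤ α * η ^ 2)
        (_hRlev : ∀ (j : ℕ) (b : Bond d (towerP L m (j + 1))) (w : W), ‖adTransportW φ (UlevOf L m (n + 1) U j) b w‖ ≤ ‖w‖)
        (_hεg : ∀ j < n + 1, εU j ≤ α * ϱ ^ j) (_hAQ : ∑ j ∈ Finset.range (n + 1), αU j ≤ AQ)
        (hpos' : ∀ x : SiteL2K ℂ d (towerP L m (n + 1)) c₀ W, x ≠ 0 → 0 < RCLike.re ⟪x, laplacePrimeAk L m n φ η U a' (c₁ := c₁) x⟫_ℂ)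
        (hpos : ∀ x : BondL2K ℂ d (towerP L m (n + 1)) c₀ W, x ≠ 0 →
          0 < RCLike.re ⟪x, laplaceAk L m n φ η U hL αU hα1 hU1 hreg τ (c₀ := c₀) (c₁ := c₁) a x⟫_ℂ)
        (_hc₀η : c₀ = η ^ d) (j₀ : ℝ) (_hJ : ∀ μ y, ‖B9Eq39Adjoint.J (fun μ => B9Eq33CovDerivVector.shiftEquiv μ) (fun μ y => U (y, μ)) η μ y‖ ≤ j₀) (_hj : j₀ ≤ j₁)
        (hposπ : ∀ x : BondL2K ℂ d (towerP L m (n + 1)) c₀ W, x ≠ 0 →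
          0 < RCLike.re ⟪x, laplaceAkPi L m n φ τ η U a' hpos' hL αU hα1 hU1 hreg (c₁ := c₁) a x⟫_ℂ)
        (hQ : Function.Surjective (QkW L m n φ U hL αU hα1 hU1 hreg (c₀ := c₀) (c₁ := c₁)))
        (hpos'₁ : ∀ x : SiteL2K ℂ d (towerP L m (n + 1)) c₀ W, x ≠ 0 →
          0 < RCLike.re ⟪x, laplacePrimeAk L m n φ η (fun _ : Bond d (towerP L m (n + 1)) => (1 : 𝔸ˣ)) a' (c₁ := c₁) x⟫_ℂ)
        (hpos₁ : ∀ x : BondL2K ℂ d (towerP L m (n + 1)) c₀ W, x ≠ 0 →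
          0 < RCLike.re ⟪x, laplaceAk L m n φ η (fun _ : Bond d (towerP L m (n + 1)) => (1 : 𝔸ˣ)) hL (fun _ => 0) (fun _ => by norm_num)
            (perCfg_UlevOf_one_mem_U1 L m (n + 1)) (norm_Wcx_UlevOf_one_sub_one_le L m (n + 1) (fun _ => 0) (fun _ => le_rfl)) τ
            (c₀ := c₀) (c₁ := c₁) a x⟫_ℂ)
        (hQ1 : Function.Surjective (QkW L m n φ (fun _ : Bond d (towerP L m (n + 1)) => (1 : 𝔸ˣ)) hL (fun _ => 0) (fun _ => by norm_num)
          (perCfg_UlevOf_one_mem_U1 L m (n + 1)) (norm_Wcx_UlevOf_one_sub_one_le L m (n + 1) (fun _ => 0) (fun _ => le_rfl)) (c₀ := c₀) (c₁ := c₁)))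
        (lev₀ : Bond d (towerP L m (n + 1)) → ℕ) (levB : Bond d m → ℕ) (lev₁ : Bond d (towerP L m (n + 1)) × Fin d → ℕ),
        -- (K_ι) the jet identity `∇_U → ∇_1`, height-free
        (∀ f : Space115 (L : ℝ) η lev₀ lev₁ (nabla115 η U),
          ‖LinearMap.toContinuousLinearMap
              ((jetLinearEquiv (L : ℝ) η lev₀ lev₁ (nabla115 η (fun _ : Bond d (towerP L m (n + 1)) => (1 : 𝔸ˣ)))).symm.toLinearMap ∘ₗ
                (jetLinearEquiv (L : ℝ) η lev₀ lev₁ (nabla115 η U)).toLinearMap) f‖ ≤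
            (1 + (NegSup.wSup (levWeight (L : ℝ) η lev₁ 2) : ℝ) * (2 * α) * NegSup.wInvSup (levWeight (L : ℝ) η lev₀ 1)) * ‖f‖) ∧
        -- (δ_A) the `H₁`-letter across the two norms, height- and volume-free
        (∀ B : NegSize (L : ℝ) η levB 0 𝔸,
          ‖LinearMap.toContinuousLinearMap
              ((jetLinearEquiv (L : ℝ) η lev₀ lev₁ (nabla115 η (fun _ : Bond d (towerP L m (n + 1)) => (1 : 𝔸ˣ)))).symm.toLinearMap ∘ₗ
                (jetLinearEquiv (L : ℝ) η lev₀ lev₁ (nabla115 η U)).toLinearMap)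
              (H1LatticeCLM (L := (L : ℝ)) (η := η) (lev₀ := lev₀) (levB := levB) φ hposπ hQ lev₁ (nabla115 η U) B) -
            H1LatticeCLM (L := (L : ℝ)) (η := η) (lev₀ := lev₀) (levB := levB) (c := ((η : ℂ))⁻¹)
              (R := adTransportW φ (fun _ : Bond d (towerP L m (n + 1)) => (1 : 𝔸ˣ)))
              (S := adTransportW φ fun _ : Bond d (towerP L m (n + 1)) => (1 : 𝔸ˣ)⁻¹) (Δ₁ := hessOp φ η (fun _ : Bond d (towerP L m (n + 1)) => (1 : 𝔸ˣ)) τ)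
              (Rr := RofUk L m n φ η (fun _ : Bond d (towerP L m (n + 1)) => (1 : 𝔸ˣ)))
              (Q := (QkW L m n φ (fun _ : Bond d (towerP L m (n + 1)) => (1 : 𝔸ˣ)) hL (fun _ => 0) (fun _ => by norm_num)
                (perCfg_UlevOf_one_mem_U1 L m (n + 1)) (norm_Wcx_UlevOf_one_sub_one_le L m (n + 1) (fun _ => 0) (fun _ => le_rfl)) (c₀ := c₀) (c₁ := c₁))) (a := a)
              φ hpos₁ hQ1 lev₁ (nabla115 η (fun _ : Bond d (towerP L m (n + 1)) => (1 : 𝔸ˣ))) B‖ ≤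
            max ((NegSup.wSup (levWeight (L : ℝ) η lev₀ 1) : ℝ) * (Mφ * ((j₀ + α) * K) * Mφ')) (NegSup.wSup (levWeight (L : ℝ) η lev₁ 2) * (Mφ * ((j₀ + α) * K) * Mφ')) *
              NegSup.wInvSup (levWeight (L : ℝ) η levB 0) * ‖B‖) := by
  classical
  obtain ⟨α₀, j₁, K, hα₀, hj₁, hK, H⟩ :=
    exists_supRows_H1kPi_sub_flat hd L hL hL3 φ hMφ hMφ' hφ hφ' hstar ha ha' hϱ0 hϱ1 τ hτ hCτ hτm hMτ hρw hτ₁ hτ₂ hφτ AQ b hM₂ hrepr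
  refine ⟨α₀, j₁, K, hα₀, hj₁, hK, ?_⟩
  intro n η _ hηL c₀ c₁ _ _ hw hρ m _ hm U αU hα0 hα1 hαL hU1 hreg εU hεU hε1 hUε hLb α hα hαle hUst hUb hUη hUw hpl hUgrad hRlev hεg hAQ hpos' hpos hc₀η j₀ hJ hj
    hposπ hQ hpos'₁ hpos₁ hQ1 lev₀ levB lev₁
  obtain ⟨hT, hDT⟩ := H n η hηL c₀ c₁ hw hρ m hm U αU hα0 hα1 hαL hU1 hreg εU hεU hε1 hUε hLb α hα hαle hUst hUb hUη hUw hpl hUgrad hRlev hεg hAQ hpos' hpos hc₀η j₀ hJ hj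
    hposπ hQ hpos'₁ hpos₁
  have hη : 0 < η := Fact.out
  have hcn : ‖((η : ℂ))⁻¹‖ = η⁻¹ := by rw [norm_inv, Complex.norm_real, Real.norm_eq_abs, abs_of_pos hη]
  have hj₀ : 0 ≤ j₀ := (norm_nonneg _).trans (hJ ⟨0, hd⟩ fun _ => 0)
  have hKα : 0 ≤ (j₀ + α) * K := mul_nonneg (add_nonneg hj₀ hα) hK
  refine ⟨fun f => ?_, fun B => ?_⟩
  · -- (K_ι): `‖∇_1 − ∇_U‖ ≤ 2|η|⁻¹(αη) = 2α`
    have h := norm_jetId_le (L := (L : ℝ)) (η := η) (lev₀ := lev₀) lev₁ (nabla115 η U) (nabla115 η fun _ : Bond d (towerP L m (n + 1)) => (1 : 𝔸ˣ))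
      (by positivity) (norm_nabla115_sub_flat_le η U hUb (by positivity) hUη) f
    have e : 2 * ‖((η : ℂ))⁻¹‖ * (α * η) = 2 * α := by rw [hcn]; field_simp
    rw [e] at h
    exact h
  · -- (δ̃_A): the two letters are `H1CLM φ (∇_1) (H̃_k(U))` and `H1CLM φ (∇_1) (H_k(1))`; their difference is `H1CLM φ (∇_1) (H̃_k(U) − H_k(1))`
    set HU := H1LatticeK hposπ hQ with hHU
    set H1 := H1k L m n φ η (fun _ : Bond d (towerP L m (n + 1)) => (1 : 𝔸ˣ)) hL (fun _ => 0) (fun _ => by norm_num)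
                (perCfg_UlevOf_one_mem_U1 L m (n + 1)) (norm_Wcx_UlevOf_one_sub_one_le L m (n + 1) (fun _ => 0) (fun _ => le_rfl)) τ (c₀ := c₀) (c₁ := c₁)
                (fun _ => by norm_num) hpos₁ with hH1
    have e1 : LinearMap.toContinuousLinearMap
            ((jetLinearEquiv (L : ℝ) η lev₀ lev₁ (nabla115 η (fun _ : Bond d (towerP L m (n + 1)) => (1 : 𝔸ˣ)))).symm.toLinearMap ∘ₗ
              (jetLinearEquiv (L : ℝ) η lev₀ lev₁ (nabla115 η U)).toLinearMap)
            (H1LatticeCLM (L := (L : ℝ)) (η := η) (lev₀ := lev₀) (levB := levB) φ hposπ hQ lev₁ (nabla115 η U) B) =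
        H1CLM (L := (L : ℝ)) (η := η) (lev₀ := lev₀) (levB := levB) φ lev₁ (nabla115 η (fun _ : Bond d (towerP L m (n + 1)) => (1 : 𝔸ˣ))) HU B := rfl
    have e2 : H1LatticeCLM (L := (L : ℝ)) (η := η) (lev₀ := lev₀) (levB := levB) (c := ((η : ℂ))⁻¹)
              (R := adTransportW φ (fun _ : Bond d (towerP L m (n + 1)) => (1 : 𝔸ˣ)))
              (S := adTransportW φ fun _ : Bond d (towerP L m (n + 1)) => (1 : 𝔸ˣ)⁻¹) (Δ₁ := hessOp φ η (fun _ : Bond d (towerP L m (n + 1)) => (1 : 𝔸ˣ)) τ)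
              (Rr := RofUk L m n φ η (fun _ : Bond d (towerP L m (n + 1)) => (1 : 𝔸ˣ)))
              (Q := (QkW L m n φ (fun _ : Bond d (towerP L m (n + 1)) => (1 : 𝔸ˣ)) hL (fun _ => 0) (fun _ => by norm_num)
                (perCfg_UlevOf_one_mem_U1 L m (n + 1)) (norm_Wcx_UlevOf_one_sub_one_le L m (n + 1) (fun _ => 0) (fun _ => le_rfl)) (c₀ := c₀) (c₁ := c₁))) (a := a)
              φ hpos₁ hQ1 lev₁ (nabla115 η (fun _ : Bond d (towerP L m (n + 1)) => (1 : 𝔸ˣ))) B =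
        H1CLM (L := (L : ℝ)) (η := η) (lev₀ := lev₀) (levB := levB) φ lev₁ (nabla115 η (fun _ : Bond d (towerP L m (n + 1)) => (1 : 𝔸ˣ))) H1 B := rfl
    have e3 : H1CLM (L := (L : ℝ)) (η := η) (lev₀ := lev₀) (levB := levB) φ lev₁ (nabla115 η (fun _ : Bond d (towerP L m (n + 1)) => (1 : 𝔸ˣ))) HU B -
          H1CLM (L := (L : ℝ)) (η := η) (lev₀ := lev₀) (levB := levB) φ lev₁ (nabla115 η (fun _ : Bond d (towerP L m (n + 1)) => (1 : 𝔸ˣ))) H1 B =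
        H1CLM (L := (L : ℝ)) (η := η) (lev₀ := lev₀) (levB := levB) φ lev₁ (nabla115 η (fun _ : Bond d (towerP L m (n + 1)) => (1 : 𝔸ˣ))) (HU - H1) B := by
      unfold H1CLM
      apply (JetSup.equiv _ _ (nabla115 η (fun _ : Bond d (towerP L m (n + 1)) => (1 : 𝔸ˣ)))).injective
      rw [JetSup.equiv_sub, blockCLM115_apply, blockCLM115_apply, blockCLM115_apply, readFun_sub, LinearMap.sub_apply]
    rw [e1, e2, e3]
    have hop := norm_H1CLM_le_of_global (Lw := (L : ℝ)) (ηw := η) (lev₀ := lev₀) (levB := levB) φ hMφ hφ hMφ' hφ' η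
      (fun _ : Bond d (towerP L m (n + 1)) => (1 : 𝔸ˣ)) lev₁ (HU - H1) hKα hKα hT hDT
    exact (ContinuousLinearMap.le_opNorm _ _).trans (mul_le_mul_of_nonneg_right hop (norm_nonneg _))

end Literature.MathematicalPhysics.QuantumFieldTheory.Balaban1983to89.B11Eq117H1kPiLetterDefectAtFlatLatticeFree

end
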